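import Mathlib

/-!
# Line `Sketch` of crux `PhononMeanFreePath.CoherentDephasing` (stmt-AtomisticToContinuum-11810): the telescoping arithmetic

Helper file (pure real analysis, no chain objects) for the lead's skeleton `Cruxes/CoherentDephasing/Lines/Sketch.lean`:
the sorry-free composition of the line's block Beer–Lambert law. At one parameter point let `J_N b` be the time-integrated
coherent energy flux through bond `b` of the `(N+1)`-site chain, `A_N b` the work absorbed strictly to its right and
`D_N = γ ∫₀^∞ m_N²` the far-bath dissipation of the mean field, tied by the right energy balance `J_N b = D_N + A_N b`.

* `max_flux_step` — block absorption `A b - A b' ≥ (1-θ)·max(J b, 0)` for `b' ≥ b + L₀` gives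
  `max(J b', 0) ≤ θ·max(J b, 0)`;
* `max_flux_iter` — telescoping along `i₀, i₀ + L₀, …, i₀ + k L₀`: `max(J (i₀ + kL₀), 0) ≤ θ^k max(J i₀, 0)`;
* `dissipation_le_geometric` — with a head bound `J b ≤ B` (`b < L₀`) and a contact bound `A b₁ ≥ -C·max(J b₁, 0)` at
  `b₁ = N-1-L₁`: `D_N ≤ (1+C)·max(B,0)·θ^{(N-1-L₁)/L₀}`;
* `tendsto_natMul_pow_div` — `N · θ^{(N-c)/L} → 0` for `0 ≤ θ < 1`, `L ≥ 1` (natural-number division).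

Everything is stated for abstract real families, so that the skeleton's assembly `CoherentDephasing_of` is a few lines.
-/

noncomputable section

open Filter Topology

namespace Summit.AtomisticToContinuum.FouriersLaw.Theorems.CoherentDephasing.Telescoping


section Telescoping

variable {N : ℕ} {J A : Fin N → ℝ} {D θ : ℝ} {L₀ : ℕ}

/-- [folklore] One Beer–Lambert step: right balance `J = D + A` and block absorption give
`max(J b', 0) ≤ θ·max(J b, 0)` for bulk pairs `b' ≥ b + L₀`, `b' + L₀ ≤ N`. -/
theorem max_flux_step (hθ : 0 ≤ θ) (hRB : ∀ b : Fin N, J b = D + A b)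
    (hblock : ∀ b b' : Fin N, (b : ℕ) + L₀ ≤ (b' : ℕ) → (b' : ℕ) + L₀ ≤ N →
      (1 - θ) * max (J b) 0 ≤ A b - A b')
    {b b' : Fin N} (h : (b : ℕ) + L₀ ≤ (b' : ℕ)) (h' : (b' : ℕ) + L₀ ≤ N) :
    max (J b') 0 ≤ θ * max (J b) 0 := by
  have hb := hblock b b' h h'
  have hJ : J b' = J b - (A b - A b') := by rw [hRB b, hRB b']; ring
  have hm : 0 ≤ max (J b) 0 := le_max_right _ _
  refine max_le ?_ (mul_nonneg hθ hm)
  rw [hJ]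
  rcases le_or_gt 0 (J b) with hpos | hneg
  · rw [max_eq_left hpos] at hb ⊢
    nlinarith
  · rw [max_eq_right hneg.le] at hb ⊢
    nlinarith

/-- [folklore] Telescoping the block law: `max(J (i₀ + k L₀), 0) ≤ θ^k · max(J i₀, 0)` along the chain of bonds
`i₀, i₀ + L₀, …, i₀ + k L₀` (as long as the last one is at least `L₀` bonds from the far end). -/
theorem max_flux_iter (hL₀ : 0 < L₀) (hθ : 0 ≤ θ) (hRB : ∀ b : Fin N, J b = D + A b)
    (hblock : ∀ b b' : Fin N, (b : ℕ) + L₀ ≤ (b' : ℕ) → (b' : ℕ) + L₀ ≤ N →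
      (1 - θ) * max (J b) 0 ≤ A b - A b')
    (i₀ : ℕ) : ∀ (k : ℕ) (hk : i₀ + k * L₀ + L₀ ≤ N),
      max (J ⟨i₀ + k * L₀, by omega⟩) 0 ≤ θ ^ k * max (J ⟨i₀, by omega⟩) 0 := by
  intro k
  induction k with
  | zero => intro hk; simp
  | succ k ih =>
    intro hk
    have hmul : (k + 1) * L₀ = k * L₀ + L₀ := by rw [Nat.add_mul, one_mul]
    have hk' : i₀ + k * L₀ + L₀ ≤ N := by rw [hmul] at hk; omega
    have hlt' : i₀ + (k + 1) * L₀ < N := by rw [hmul] at hk ⊢; omega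
    have hstep := max_flux_step hθ hRB hblock (b := ⟨i₀ + k * L₀, by omega⟩) (b' := ⟨i₀ + (k + 1) * L₀, hlt'⟩)
      (by simp only [hmul]; omega) hk
    calc max (J ⟨i₀ + (k + 1) * L₀, hlt'⟩) 0 ≤ θ * max (J ⟨i₀ + k * L₀, by omega⟩) 0 := hstep
      _ ≤ θ * (θ ^ k * max (J ⟨i₀, by omega⟩) 0) := mul_le_mul_of_nonneg_left (ih hk') hθ
      _ = θ ^ (k + 1) * max (J ⟨i₀, by omega⟩) 0 := by ring

end Telescoping

/-- [folklore] **Geometric bound on the bath dissipation at the far end.** At one parameter point, if for every `N` the right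
balance `J_N b = D_N + A_N b` holds for all bonds, the bulk block law holds with `(L₀, θ)`, the head bound with `B` on the
first `L₀` bonds and the contact bound with `(L₁, C)`, `L₀ ≤ L₁ + 1`, then `D_N ≤ (1+C)·max(B,0)·θ^{(N-1-L₁)/L₀}` for
`N ≥ L₁ + 1` (natural-number division). -/
theorem dissipation_le_geometric :
    ∀ (J A : (N : ℕ) → Fin N → ℝ) (D : ℕ → ℝ) (θ B C : ℝ) (L₀ L₁ : ℕ), 0 < L₀ → 0 ≤ θ → 0 ≤ C → L₀ ≤ L₁ + 1 →
      (∀ (N : ℕ) (b : Fin N), J N b = D N + A N b) →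
      (∀ (N : ℕ) (b b' : Fin N), (b : ℕ) + L₀ ≤ (b' : ℕ) → (b' : ℕ) + L₀ ≤ N →
        (1 - θ) * max (J N b) 0 ≤ A N b - A N b') →
      (∀ (N : ℕ) (b : Fin N), (b : ℕ) < L₀ → J N b ≤ B) →
      (∀ (N : ℕ) (b : Fin N), (b : ℕ) + 1 + L₁ = N → -(C * max (J N b) 0) ≤ A N b) →
      ∀ N : ℕ, L₁ + 1 ≤ N → D N ≤ (1 + C) * max B 0 * θ ^ ((N - 1 - L₁) / L₀) := by
  intro J A D θ B C L₀ L₁ hL₀ hθ hC hL hRB hblock hhead hcontact N hN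
  -- the reference bond `b₁ = N - 1 - L₁ = i₀ + k L₀` with `i₀ < L₀`
  set b₁ : ℕ := N - 1 - L₁ with hb₁
  have hb₁N : b₁ + L₀ ≤ N := by omega
  set k : ℕ := b₁ / L₀ with hk
  set i₀ : ℕ := b₁ % L₀ with hi₀
  have hdecomp : i₀ + k * L₀ = b₁ := by
    have := Nat.mod_add_div b₁ L₀
    rw [hi₀, hk]; linarith [Nat.mod_add_div b₁ L₀, mul_comm L₀ (b₁ / L₀)]
  have hi₀L : i₀ < L₀ := Nat.mod_lt _ hL₀
  have hkN : i₀ + k * L₀ + L₀ ≤ N := by omega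
  have hkN' : i₀ + k * L₀ < N := by omega
  have hiter := max_flux_iter (N := N) (J := J N) (A := A N) (D := D N) hL₀ hθ (hRB N) (hblock N) i₀ k hkN
  have hhead' : max (J N ⟨i₀, by omega⟩) 0 ≤ max B 0 :=
    max_le_max (hhead N ⟨i₀, by omega⟩ hi₀L) le_rfl
  have hθk : 0 ≤ θ ^ k := pow_nonneg hθ k
  have hmaxb₁ : max (J N ⟨i₀ + k * L₀, hkN'⟩) 0 ≤ θ ^ k * max B 0 :=
    hiter.trans (mul_le_mul_of_nonneg_left hhead' hθk)
  -- contact: `D = J b₁ - A b₁ ≤ (1 + C) max(J b₁, 0)`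
  have hc := hcontact N ⟨i₀ + k * L₀, hkN'⟩ (by simp only; omega)
  have hD : D N = J N ⟨i₀ + k * L₀, hkN'⟩ - A N ⟨i₀ + k * L₀, hkN'⟩ := by rw [hRB N]; ring
  have hJle : J N ⟨i₀ + k * L₀, hkN'⟩ ≤ max (J N ⟨i₀ + k * L₀, hkN'⟩) 0 := le_max_left _ _
  have hm0 : 0 ≤ max (J N ⟨i₀ + k * L₀, hkN'⟩) 0 := le_max_right _ _
  have hkey : D N ≤ (1 + C) * max (J N ⟨i₀ + k * L₀, hkN'⟩) 0 := by rw [hD]; nlinarith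
  show D N ≤ (1 + C) * max B 0 * θ ^ k
  calc D N ≤ (1 + C) * max (J N ⟨i₀ + k * L₀, hkN'⟩) 0 := hkey
    _ ≤ (1 + C) * (θ ^ k * max B 0) := mul_le_mul_of_nonneg_left hmaxb₁ (by linarith)
    _ = (1 + C) * max B 0 * θ ^ k := by ring

/-- [folklore] `N · θ^{(N - c)/L} → 0` for `0 ≤ θ < 1`, `L ≥ 1` (natural-number division): `N ≤ L((N-c)/L + 1) + c` and
`(m + 1) θ^m, θ^m → 0`. -/
theorem tendsto_natMul_pow_div :
    ∀ (θ : ℝ), 0 ≤ θ → θ < 1 → ∀ (L : ℕ), 0 < L → ∀ c : ℕ,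
      Filter.Tendsto (fun N : ℕ => (N : ℝ) * θ ^ ((N - c) / L)) Filter.atTop (nhds 0) := by
  intro θ hθ hθ1 L hL c
  -- comparison sequence in the variable `m = (N - c) / L`
  have hg : Tendsto (fun m : ℕ => ((L : ℝ) * (m + 1) + c) * θ ^ m) atTop (𝓝 0) := by
    have h1 := tendsto_self_mul_const_pow_of_lt_one hθ hθ1
    have h2 := tendsto_pow_atTop_nhds_zero_of_lt_one hθ hθ1
    have h3 : Tendsto (fun m : ℕ => (L : ℝ) * ((m : ℝ) * θ ^ m) + ((L : ℝ) + c) * θ ^ m) atTop (𝓝 0) := by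
      have := (h1.const_mul (L : ℝ)).add (h2.const_mul ((L : ℝ) + c))
      simpa using this
    refine h3.congr fun m => ?_
    ring
  have hm : Tendsto (fun N : ℕ => (N - c) / L) atTop atTop :=
    (Nat.tendsto_div_const_atTop hL.ne').comp (tendsto_sub_atTop_nat c)
  have hcomp := hg.comp hm
  refine squeeze_zero' (Eventually.of_forall fun N => by positivity) ?_ hcomp
  filter_upwards [eventually_ge_atTop c] with N hNc
  simp only [Function.comp_apply]
  have hθm : 0 ≤ θ ^ ((N - c) / L) := pow_nonneg hθ _
  refine mul_le_mul_of_nonneg_right ?_ hθm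
  -- `N ≤ L * ((N - c)/L + 1) + c`
  have hnat : N ≤ L * ((N - c) / L + 1) + c := by
    have h1 : (N - c) % L < L := Nat.mod_lt _ hL
    have h2 := Nat.mod_add_div (N - c) L
    have h3 : N - c < L * ((N - c) / L + 1) := by
      rw [mul_add, mul_one]; omega
    omega
  have : (N : ℝ) ≤ (L : ℝ) * (((N - c) / L : ℕ) + 1) + c := by exact_mod_cast hnat
  simpa using this


end Summit.AtomisticToContinuum.FouriersLaw.Theorems.CoherentDephasing.Telescoping

end
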